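import Literature.Probability.RandomPlanarGeometry.SAWBridgeZigzag
import Literature.Probability.RandomPlanarGeometry.SAWBridgeSparseLevels
import HarnessLib

/-!
# Duminil-Copin–Hammond 2013, Proposition 3.2, Case 3: the multi-valued unfolding map, counted

Topic `Literature/Probability/RandomPlanarGeometry` (continues `SAWBridgeZigzag.lean` (zigzags `Zd.zigzags`, the
unfolding `Zd.unfoldZigzags`, renewal times `Zd.renewalTimes`, the Case-3 reconstruction bound
`Zd.card_le_choose_of_unfoldZigzags_eq`), `SAWBridgeSparseLevels.lean` (`Zd.highBridges = SAB_{n,v}`,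
`Zd.sparseHighBridges = SAB^m_{n,v,δ}`), `SAWBridgeRenewalDensity.lean` (`Zd.renewalCount = |R_γ|`)).

Source: H. Duminil-Copin, A. Hammond, *Self-avoiding walk is sub-ballistic*, Comm. Math. Phys. 324 (2013)
401–423, arXiv:1205.0401 [DuminilCopinHammond2013], proof of Proposition 3.2, Case 3 "many zigzags and few
renewal points" (arXiv v1, pp. 15–17; equation numbers as printed there): the multi-valued map `MultiUnf(γ) = {Unf_Z(γ) : Z ⊆ shortZZ_γ, |Z| = ⌊δ''v_n⌋}`,
its forward count (3.8) `|MultiUnf(γ)| = binom(|shortZZ_γ|, δ''v_n)`, the image property "`|R_φ| ≥ δ''n`"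
(3.7), the renewal bound (3.9) "`|R_φ| ≤ ε_n v_n + 3⌈1/δ'⌉δ''v_n`", and the reconstruction count
(3.10) "the number of pairs `(γ, Z)` such that `Unf_Z(γ) = φ` is at most `binom((ε_n + 3⌈1/δ'⌉δ'')v_n, δ''v_n)
· ⌈1/δ'⌉^{δ''v_n}`".

This file proves the resulting DOUBLE COUNT as one inequality between cardinalities (the lane's «DCH-1.1»
hypothesis H3 of lit-1's assembly `dch_prop32_of_counts`, term of record 2026-08-22T11:05:33Z):
**`Zd.card_sparseHighBridges_filter_zigzags_mul_choose_le`** —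
`#{γ ∈ SAB^k_{n,v,δ} : a + ⌊n/(L+1)⌋ ≤ #(non-degenerate zigzags of γ), |R_γ| ≤ r} · binom(a, t)
  ≤ binom((r + 3Lt)·L, t) · #{φ ∈ SAB_{n,v} : t ≤ |R_φ|}`.
DEVIATIONS from print (all inherited from `SAWBridgeZigzag.lean`'s as-printed deltas): the map runs over
NON-DEGENERATE short zigzags (Δ1: `Unf_{(i,i)} = id`), and the reconstruction multiplicity is
`binom(|R_φ|·L, t)` (lit-2's `card_le_choose_of_unfoldZigzags_eq`) instead of `binom(|R_φ|, t)·⌈1/δ'⌉^t` —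
the two have the same quotient in Lemma 3.8; "short" means central length `≤ L`, and at most `⌊n/(L+1)⌋`
zigzags are longer (Lemma 3.3 (1), `card_filter_long_zigzags_mul_le`).
-/

noncomputable section

open Finset Function Literature.Probability.LatticeModels Literature.Probability.Percolation SimpleGraph
open scoped BigOperators

namespace Literature.Probability.RandomPlanarGeometry.SAW.Zd

/-! ### H3 — the Case-3 multi-valued-map count (a-p3 g4) -/

section H3

variable {d : ℕ} [NeZero d]

/-- The lane's `renewalCount` is the cardinality of the layer's `renewalTimes`. [cite: DuminilCopinHammond2013, §2.2] -/
theorem renewalCount_eq_card_renewalTimes (n : ℕ) (ω : ℕ → Site d) :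
    renewalCount n ω = #(renewalTimes n ω) := by
  classical
  unfold renewalCount renewalTimes
  congr 1

/-- **Proposition 3.2, Case 3 — the multi-valued map count (displays (3.7)–(3.10))**: among the bridges of
`SAB^k_{n,v,δ}` having at least `a + ⌊n/(L+1)⌋` non-degenerate zigzags and at most `r` renewal times, each
has at least `a` non-degenerate zigzags of central length `≤ L` (at most `⌊n/(L+1)⌋` are longer, Lemma 3.3
(1)), hence at least `binom(a,t)` distinct unfoldings `Unf_Z(γ)`, `|Z| = t` (injectivity on non-degenerate
zigzags), each a bridge of `SAB_{n,v}` (Lemma 3.7) with at least `t` renewal times (Lemma 3.5 (1)); and every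
such image `φ` has at most `binom((r + 3Lt)·L, t)` preimages (`|R_φ| ≤ r + 3Lt` by the renewal-growth bound,
`Z ⊆` the candidate pairs at the renewal times of `φ`, `γ = Unf_Z(φ)`). Double counting gives the stated
inequality (the printed multiplicity `binom(|R_φ|, δ''n)·⌈1/δ'⌉^{δ''n}` is replaced by lit-2's
`binom(|R_φ|·L, t)`, same Lemma-3.8 quotient).
[cite: DuminilCopinHammond2013, proof of Prop. 3.2, Case 3, (3.7)–(3.10) (arXiv v1, pp. 15–16)] -/
theorem card_sparseHighBridges_filter_zigzags_mul_choose_le (n : ℕ) (v δ : ℝ) (k L t a r : ℕ)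
    (hL : 1 ≤ L) :
    #((sparseHighBridges d n v δ k).filter fun γ =>
        a + n / (L + 1) ≤ #((zigzags n γ).filter fun z => z.1 < z.2) ∧ renewalCount n γ ≤ r) * a.choose t ≤
      ((r + 3 * L * t) * L).choose t * #((highBridges d n v).filter fun φ => t ≤ renewalCount n φ) := by
  classical
  set G := (sparseHighBridges d n v δ k).filter fun γ =>
      a + n / (L + 1) ≤ #((zigzags n γ).filter fun z => z.1 < z.2) ∧ renewalCount n γ ≤ r with hG
  set T := (highBridges d n v).filter fun φ => t ≤ renewalCount n φ with hT
  -- the relation "φ is an unfolding of γ along a t-set of short non-degenerate zigzags"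
  let R : (ℕ → Site d) → (ℕ → Site d) → Prop := fun γ φ =>
    ∃ Z : Finset (ℕ × ℕ), Z ⊆ ((zigzags n γ).filter fun z => z.1 < z.2).filter (fun z => z.2 - z.1 ≤ L) ∧
      #Z = t ∧ unfoldZigzags Z γ = φ
  rw [mul_comm (((r + 3 * L * t) * L).choose t)]
  refine Finset.card_mul_le_card_mul R (fun γ hγ => ?_) (fun φ hφ => ?_)
  · -- forward count
    rw [hG, mem_filter, sparseHighBridges, mem_filter, highBridges, mem_filter] at hγ
    obtain ⟨⟨⟨hγb, hvn⟩, -⟩, hzz, hR⟩ := hγ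
    set ND := ((zigzags n γ).filter fun z => z.1 < z.2).filter (fun z => z.2 - z.1 ≤ L) with hND
    have hNDsub : ND ⊆ zigzags n γ := fun z hz => (mem_filter.1 (mem_filter.1 hz).1).1
    have hNDnd : ∀ z ∈ ND, z.1 < z.2 := fun z hz => (mem_filter.1 (mem_filter.1 hz).1).2
    -- at least `a` short non-degenerate zigzags
    have hcard : a ≤ #ND := by
      have hsplit := Finset.card_filter_add_card_filter_not (s := (zigzags n γ).filter fun z => z.1 < z.2)
        (fun z => z.2 - z.1 ≤ L)
      have hlong : #(((zigzags n γ).filter fun z => z.1 < z.2).filter fun z => ¬ z.2 - z.1 ≤ L) ≤ n / (L + 1) := by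
        rw [Nat.le_div_iff_mul_le (by omega)]
        calc #(((zigzags n γ).filter fun z => z.1 < z.2).filter fun z => ¬ z.2 - z.1 ≤ L) * (L + 1)
            ≤ #((zigzags n γ).filter fun z => L + 1 ≤ z.2 - z.1) * (L + 1) := by
              gcongr
              intro z hz
              rw [mem_filter] at hz ⊢
              exact ⟨(mem_filter.1 hz.1).1, by omega⟩
          _ ≤ n := card_filter_long_zigzags_mul_le n γ (L + 1)
      rw [← hND] at hsplit
      omega
    calc a.choose t ≤ (#ND).choose t := Nat.choose_le_choose t hcard
      _ = #((ND.powersetCard t).image fun Z => unfoldZigzags Z γ) :=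
          (card_image_unfoldZigzags_powersetCard hNDsub hNDnd t).symm
      _ ≤ #(T.bipartiteAbove R γ) := by
          refine card_le_card fun φ hφ => ?_
          rw [mem_image] at hφ
          obtain ⟨Z, hZ, rfl⟩ := hφ
          rw [mem_powersetCard] at hZ
          have hZsub : Z ⊆ zigzags n γ := hZ.1.trans hNDsub
          have hZnd : ∀ z ∈ Z, z.1 < z.2 := fun z hz => hNDnd z (hZ.1 hz)
          rw [Finset.mem_bipartiteAbove, hT, mem_filter, highBridges, mem_filter]
          refine ⟨⟨⟨unfoldZigzags_mem_bridges hγb hZsub, hvn.trans ?_⟩, ?_⟩, Z, hZ.1, hZ.2, rfl⟩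
          · exact_mod_cast le_unfoldZigzags_apply_last hZsub
          · rw [renewalCount_eq_card_renewalTimes]
            have := two_mul_card_le_card_renewalTimes_unfoldZigzags hγb hZsub hZnd
            rw [hZ.2] at this
            exact_mod_cast (show t ≤ #(renewalTimes n (unfoldZigzags Z γ)) by omega)
  · -- backward count
    by_cases hemp : G.bipartiteBelow R φ = ∅
    · rw [hemp, card_empty]; exact Nat.zero_le _
    obtain ⟨γ₀, hγ₀⟩ := nonempty_iff_ne_empty.2 hemp
    rw [Finset.mem_bipartiteBelow, hG, mem_filter] at hγ₀
    obtain ⟨⟨hγ₀S, -, hr₀⟩, Z₀, hZ₀, hZ₀t, hZ₀φ⟩ := hγ₀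
    have hγ₀b : γ₀ ∈ bridges d n := by
      rw [sparseHighBridges, mem_filter, highBridges, mem_filter] at hγ₀S
      exact hγ₀S.1.1
    have hZ₀sub : Z₀ ⊆ zigzags n γ₀ := fun z hz => (mem_filter.1 (mem_filter.1 (hZ₀ hz)).1).1
    -- `|R_φ| ≤ r + 3 L t`
    have hRφ : #(renewalTimes n φ) ≤ r + 3 * L * t := by
      rw [← hZ₀φ]
      have h1 := card_renewalTimes_unfoldZigzags_le hγ₀b hZ₀sub
      have h2 : ∑ z ∈ Z₀, (z.2 - z.1) ≤ t * L := by
        rw [← hZ₀t, ← smul_eq_mul, ← sum_const]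
        exact sum_le_sum fun z hz => (mem_filter.1 (hZ₀ hz)).2
      rw [renewalCount_eq_card_renewalTimes] at hr₀
      calc #(renewalTimes n (unfoldZigzags Z₀ γ₀)) ≤ #(renewalTimes n γ₀) + 3 * ∑ z ∈ Z₀, (z.2 - z.1) := h1
        _ ≤ r + 3 * (t * L) := by omega
        _ = r + 3 * L * t := by ring
    calc #(G.bipartiteBelow R φ) ≤ (#(renewalTimes n φ) * L).choose t := by
          refine card_le_choose_of_unfoldZigzags_eq n φ L t fun γ hγ => ?_
          rw [Finset.mem_bipartiteBelow, hG, mem_filter] at hγ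
          obtain ⟨⟨hγS, -, -⟩, Z, hZ, hZt, hZφ⟩ := hγ
          have hγb : γ ∈ bridges d n := by
            rw [sparseHighBridges, mem_filter, highBridges, mem_filter] at hγS
            exact hγS.1.1
          exact ⟨hγb, Z, fun z hz => (mem_filter.1 (mem_filter.1 (hZ hz)).1).1,
            fun z hz => ⟨(mem_filter.1 (mem_filter.1 (hZ hz)).1).2, (mem_filter.1 (hZ hz)).2⟩, hZt, hZφ⟩
      _ ≤ ((r + 3 * L * t) * L).choose t := Nat.choose_le_choose t (Nat.mul_le_mul_right L hRφ)

end H3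


end Literature.Probability.RandomPlanarGeometry.SAW.Zd

end
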